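import Mathlib.NumberTheory.AbelSummation
import Mathlib.NumberTheory.Chebyshev
import Mathlib.Analysis.SpecialFunctions.Integrals.Basic
import Mathlib.Analysis.SpecialFunctions.Integrability.Basic
import Mathlib.Analysis.SpecialFunctions.Pow.Deriv
import Literature.NumberTheory.LFunctions.ZetaScrew
import Literature.NumberTheory.LFunctions.PrimeNumberTheoremErrorTermProofs
import HarnessLib

/-!
# Suzuki's screw function `Ψ`: the growth bound `Ψ(t) ≪ exp(t/2 − c√t)` (proofs)

Topic `Literature/NumberTheory/LFunctions`. Everything in this file is PROVED. It discharges the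
named fact `Suzuki2023_thm11_growth` of `ZetaScrew.lean`,

* M. Suzuki, *Aspects of the screw function corresponding to the Riemann zeta-function*,
  J. Lond. Math. Soc. (2) 108 (2023), Thm 1.1 (3): `Ψ(t) ≪ exp(t/2 − c√t)` for some `c > 0`
  (`Suzuki2023_thm11_growth_holds`),

through Suzuki's Proposition 2.1 (`Suzuki2023_prop21`):
`φ(t) := ∑_{n ≤ e^t} Λ(n) n^{-1/2} (t − log n) = 4e^{t/2} + O(e^{t/2} e^{−c√t})` (`t > 0`),
and formula (1.1) (`zetaScrew_eq`), exactly as in §2.3 of the paper ("the assertion follows from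
the following proposition and (1.1)"): the remaining terms of (1.1) are `O(1 + t)`.

## The proof of Proposition 2.1 given here

The paper proves Prop. 2.1 by a truncated Perron-type integral of `z^{-2}(ζ'/ζ)(1/2 − iz)e^{−izt}`
moved into the classical zero-free region. We take the (classical, equivalent-strength) shorter
road available in the tree: the de la Vallée Poussin prime number theorem
`ψ(u) = u + O(u e^{−c√log u})` is PROVED in the tree
(`ChebyshevPsiDeLaValleePoussin_holds`, Montgomery–Vaughan Thm 6.9), and Prop. 2.1 follows from it
by Abel summation:

* `zetaScrewPrimeSum_eq_integral`: with `f_t(u) = (t − log u)u^{-1/2}` (`f_t(e^t) = 0`,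
  `f_t' = −k_t`, `k_t(u) = u^{-3/2}(1 + (t − log u)/2)`), Abel summation gives
  `φ(t) = ∫_1^{e^t} k_t(u) ψ(u) du`;
* `integral_kernel_mul_self`: `∫_1^{e^t} k_t(u) u du = 4e^{t/2} − t − 4`
  (primitive `u^{1/2}(t − log u + 4)`);
* `abs_zetaScrewPrimeSum_sub_le`: `|∫_1^{e^t} k_t(u)(ψ(u) − u) du| ≤ C(1 + t/2)∫_1^{e^t} u^{-1/2}e^{−c√log u} du`
  and, pointwise for `0 ≤ log u ≤ t`, `u^{-1/2} e^{−c√log u} ≤ (1 + e^{t/4 − c√t}) u^{-3/4}`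
  (`exp_quarter_sub_sqrt_le`: the convex function `s ↦ s²/4 − cs` of `s = √log u` is maximal at an
  endpoint of `[0, √t]`), `∫_1^{e^t} u^{-3/4} du ≤ 4e^{t/4}`; altogether
  `|φ(t) − (4e^{t/2} − t − 4)| ≤ 4C(1 + t)(e^{t/4} + e^{t/2 − c√t})`;
* `absorb`: `(1 + t)(e^{t/4} + e^{t/2 − c√t}) ≤ K_c e^{t/2 − (c/2)√t}`, so the statements hold with
  the constant `c/2`.

## References

* M. Suzuki, *Aspects of the screw function corresponding to the Riemann zeta-function*,
  J. Lond. Math. Soc. (2) 108 (2023), no. 4, 1448–1487; arXiv:2206.03682, Thm 1.1 (3), Prop. 2.1,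
  §2.3. [Suzuki2023]
* H. L. Montgomery, R. C. Vaughan, *Multiplicative Number Theory I. Classical Theory*, CUP 2007,
  Theorem 6.9 (the de la Vallée Poussin error term) and §2.1 (Abel summation). [MontgomeryVaughan2007]
-/

noncomputable section

open MeasureTheory Set intervalIntegral
open scoped Chebyshev ArithmeticFunction.vonMangoldt

namespace Literature.NumberTheory.LFunctions

namespace ZetaScrewGrowth

/-! ### Elementary exponential inequalities -/

/-- For `0 ≤ c` and `0 ≤ L ≤ T`: `exp(L/4 − c√L) ≤ 1 + exp(T/4 − c√T)` (the convex function
`s ↦ s²/4 − cs` of `s = √L ∈ [0, √T]` is bounded by the larger of its values at the endpoints).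
[folklore] -/
theorem exp_quarter_sub_sqrt_le {c L T : ℝ} (hc : 0 ≤ c) (hL : 0 ≤ L) (hLT : L ≤ T) :
    Real.exp (L / 4 - c * Real.sqrt L) ≤ 1 + Real.exp (T / 4 - c * Real.sqrt T) := by
  have hT : 0 ≤ T := hL.trans hLT
  have hsL : 0 ≤ Real.sqrt L := Real.sqrt_nonneg L
  have hLL : Real.sqrt L ^ 2 = L := Real.sq_sqrt hL
  have hTT : Real.sqrt T ^ 2 = T := Real.sq_sqrt hT
  have hst : Real.sqrt L ≤ Real.sqrt T := Real.sqrt_le_sqrt hLT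
  have hE : 0 ≤ Real.exp (T / 4 - c * Real.sqrt T) := (Real.exp_pos _).le
  rcases le_or_gt (Real.sqrt L) (4 * c) with h | h
  · have h1 : L / 4 - c * Real.sqrt L ≤ 0 := by
      nlinarith [mul_nonneg hsL (sub_nonneg.2 h)]
    calc Real.exp (L / 4 - c * Real.sqrt L) ≤ 1 := Real.exp_le_one_iff.2 h1
      _ ≤ 1 + Real.exp (T / 4 - c * Real.sqrt T) := le_add_of_nonneg_right hE
  · have h1 : L / 4 - c * Real.sqrt L ≤ T / 4 - c * Real.sqrt T := by
      nlinarith [mul_nonneg (sub_nonneg.2 hst)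
        (show 0 ≤ Real.sqrt T + Real.sqrt L - 4 * c by linarith)]
    calc Real.exp (L / 4 - c * Real.sqrt L) ≤ Real.exp (T / 4 - c * Real.sqrt T) :=
          Real.exp_le_exp.2 h1
      _ ≤ 1 + Real.exp (T / 4 - c * Real.sqrt T) := le_add_of_nonneg_left zero_le_one

/-- `(1 + t) e^{t/4} ≤ 8 e^{c²/2} e^{t/2 − (c/2)√t}` for `t ≥ 0` (`1 + t ≤ 8e^{t/8}` and
`t/8 − (c/2)√t + c²/2 = (√t − 2c)²/8 ≥ 0`). [folklore] -/
theorem one_add_mul_exp_quarter_le (c : ℝ) {t : ℝ} (ht : 0 ≤ t) :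
    (1 + t) * Real.exp (t / 4) ≤
      8 * Real.exp (c ^ 2 / 2) * Real.exp (t / 2 - c / 2 * Real.sqrt t) := by
  have hs : Real.sqrt t ^ 2 = t := Real.sq_sqrt ht
  have h1 : 1 + t ≤ 8 * Real.exp (t / 8) := by
    have := Real.add_one_le_exp (t / 8)
    linarith
  have h2 : t / 8 + t / 4 ≤ c ^ 2 / 2 + (t / 2 - c / 2 * Real.sqrt t) := by
    nlinarith [sq_nonneg (Real.sqrt t - 2 * c)]
  calc (1 + t) * Real.exp (t / 4) ≤ 8 * Real.exp (t / 8) * Real.exp (t / 4) :=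
        mul_le_mul_of_nonneg_right h1 (Real.exp_pos _).le
    _ = 8 * Real.exp (t / 8 + t / 4) := by rw [Real.exp_add]; ring
    _ ≤ 8 * Real.exp (c ^ 2 / 2 + (t / 2 - c / 2 * Real.sqrt t)) :=
        mul_le_mul_of_nonneg_left (Real.exp_le_exp.2 h2) (by norm_num)
    _ = 8 * Real.exp (c ^ 2 / 2) * Real.exp (t / 2 - c / 2 * Real.sqrt t) := by
        rw [Real.exp_add]; ring

/-- `(1 + t) e^{−(c/2)√t} ≤ 1 + 8/c²` for `t ≥ 0`, `c > 0` (from `e^y ≥ 1 + y²/2`, `y = (c/2)√t`).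
[folklore] -/
theorem one_add_mul_exp_neg_sqrt_le {c t : ℝ} (hc : 0 < c) (ht : 0 ≤ t) :
    (1 + t) * Real.exp (-(c / 2 * Real.sqrt t)) ≤ 1 + 8 / c ^ 2 := by
  have hs : Real.sqrt t ^ 2 = t := Real.sq_sqrt ht
  have hy : 0 ≤ c / 2 * Real.sqrt t := by positivity
  have hc2 : 0 < c ^ 2 := by positivity
  have h1 : 1 + (c / 2 * Real.sqrt t) ^ 2 / 2 ≤ Real.exp (c / 2 * Real.sqrt t) := by
    have := Real.quadratic_le_exp_of_nonneg hy
    linarith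
  have h2 : 1 + t ≤ (1 + 8 / c ^ 2) * Real.exp (c / 2 * Real.sqrt t) := by
    calc 1 + t ≤ 1 + t + (c ^ 2 * t / 8 + 8 / c ^ 2) := le_add_of_nonneg_right (by positivity)
      _ = (1 + 8 / c ^ 2) * (1 + (c / 2 * Real.sqrt t) ^ 2 / 2) := by
          rw [mul_pow, hs]
          field_simp
          ring
      _ ≤ (1 + 8 / c ^ 2) * Real.exp (c / 2 * Real.sqrt t) :=
          mul_le_mul_of_nonneg_left h1 (by positivity)
  rw [Real.exp_neg, ← div_eq_mul_inv, div_le_iff₀ (Real.exp_pos _)]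
  exact h2

/-- Absorption of the polynomial factors: for `c > 0`, `t ≥ 0`,
`(1 + t)(e^{t/4} + e^{t/2 − c√t}) ≤ (8e^{c²/2} + 1 + 8/c²) e^{t/2 − (c/2)√t}`. [folklore] -/
theorem absorb {c t : ℝ} (hc : 0 < c) (ht : 0 ≤ t) :
    (1 + t) * (Real.exp (t / 4) + Real.exp (t / 2 - c * Real.sqrt t)) ≤
      (8 * Real.exp (c ^ 2 / 2) + (1 + 8 / c ^ 2)) * Real.exp (t / 2 - c / 2 * Real.sqrt t) := by
  have h1 := one_add_mul_exp_quarter_le c ht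
  have h2 := one_add_mul_exp_neg_sqrt_le hc ht
  have h3 : Real.exp (t / 2 - c * Real.sqrt t) =
      Real.exp (-(c / 2 * Real.sqrt t)) * Real.exp (t / 2 - c / 2 * Real.sqrt t) := by
    rw [← Real.exp_add]; congr 1; ring
  have hE := Real.exp_pos (t / 2 - c / 2 * Real.sqrt t)
  calc (1 + t) * (Real.exp (t / 4) + Real.exp (t / 2 - c * Real.sqrt t))
      = (1 + t) * Real.exp (t / 4) +
          (1 + t) * Real.exp (-(c / 2 * Real.sqrt t)) * Real.exp (t / 2 - c / 2 * Real.sqrt t) := by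
        rw [h3]; ring
    _ ≤ 8 * Real.exp (c ^ 2 / 2) * Real.exp (t / 2 - c / 2 * Real.sqrt t) +
          (1 + 8 / c ^ 2) * Real.exp (t / 2 - c / 2 * Real.sqrt t) :=
        add_le_add h1 (mul_le_mul_of_nonneg_right h2 hE.le)
    _ = (8 * Real.exp (c ^ 2 / 2) + (1 + 8 / c ^ 2)) * Real.exp (t / 2 - c / 2 * Real.sqrt t) := by
        ring

/-- `∫_1^{e^t} u^{-3/4} du ≤ 4 e^{t/4}` for `t ≥ 0`. [folklore] -/
theorem integral_rpow_neg_three_quarters_le {t : ℝ} (ht : 0 ≤ t) :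
    ∫ u in (1 : ℝ)..Real.exp t, u ^ (-(3 / 4 : ℝ)) ≤ 4 * Real.exp (t / 4) := by
  rw [integral_rpow (Or.inl (by norm_num))]
  have h1 : Real.exp t ^ (-(3 / 4 : ℝ) + 1) = Real.exp (t / 4) := by
    rw [← Real.exp_mul]; congr 1; ring
  rw [h1, Real.one_rpow, show (-(3 / 4 : ℝ) + 1) = 1 / 4 by norm_num,
    div_le_iff₀ (by norm_num : (0 : ℝ) < 1 / 4)]
  have := Real.one_le_exp (show 0 ≤ t / 4 by positivity)
  linarith

/-! ### The prime number theorem input -/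

/-- The de la Vallée Poussin bound down to `u ≥ 1`: there are `c > 0` and `C ≥ 0` with
`|ψ(u) − u| ≤ C u e^{−c√log u}` for all `u ≥ 1` (for `u ≥ 2` this is Montgomery–Vaughan
Thm 6.9 (6.12), PROVED in the tree as `ChebyshevPsiDeLaValleePoussin_holds`; on `[1, 2)` one has
`ψ(u) = 0` and `√log u ≤ 1`). [cite: MontgomeryVaughan2007, Theorem 6.9 (6.12)] -/
theorem exists_abs_psi_sub_le_one_le :
    ∃ c : ℝ, 0 < c ∧ ∃ C : ℝ, 0 ≤ C ∧ ∀ u : ℝ, 1 ≤ u →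
      |ψ u - u| ≤ C * u * Real.exp (-(c * Real.sqrt (Real.log u))) := by
  obtain ⟨c, hc, C, hC⟩ := ChebyshevPsiDeLaValleePoussin_holds
  refine ⟨c, hc, max C 0 + Real.exp c, by positivity, fun u hu ↦ ?_⟩
  have hu0 : 0 < u := one_pos.trans_le hu
  have hE := Real.exp_pos (-(c * Real.sqrt (Real.log u)))
  rcases le_or_gt 2 u with h2 | h2
  · have h := hC u h2
    rw [div_eq_mul_inv, ← Real.exp_neg] at h
    refine h.trans ?_
    exact mul_le_mul_of_nonneg_right (mul_le_mul_of_nonneg_right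
      (by linarith [le_max_left C 0, Real.exp_pos c]) hu0.le) hE.le
  · have hψ : ψ u = 0 := Chebyshev.psi_eq_zero_of_lt_two h2
    have hlog1 : Real.log u ≤ 1 := by
      have := Real.log_le_sub_one_of_pos hu0
      linarith
    have hsq : Real.sqrt (Real.log u) ≤ 1 :=
      (Real.sqrt_le_sqrt hlog1).trans_eq Real.sqrt_one
    have hexp : Real.exp (-c) ≤ Real.exp (-(c * Real.sqrt (Real.log u))) := by
      rw [Real.exp_le_exp]
      have := mul_le_mul_of_nonneg_left hsq hc.le
      linarith
    rw [hψ, zero_sub, abs_neg, abs_of_pos hu0]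
    calc u = Real.exp c * u * Real.exp (-c) := by
          rw [mul_right_comm, ← Real.exp_add, add_neg_cancel, Real.exp_zero, one_mul]
      _ ≤ Real.exp c * u * Real.exp (-(c * Real.sqrt (Real.log u))) :=
          mul_le_mul_of_nonneg_left hexp (by positivity)
      _ ≤ (max C 0 + Real.exp c) * u * Real.exp (-(c * Real.sqrt (Real.log u))) :=
          mul_le_mul_of_nonneg_right (mul_le_mul_of_nonneg_right
            (by linarith [le_max_right C 0]) hu0.le) hE.le

/-! ### The Abel weight `(t − log u) u^{-1/2}` and the kernel `u^{-3/2}(1 + (t − log u)/2)` -/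

/-- `u⁻¹ u^{-1/2} = u^{-3/2}` for `u > 0`. [folklore] -/
theorem inv_mul_rpow_neg_half {u : ℝ} (hu : 0 < u) :
    u⁻¹ * u ^ (-(1 / 2 : ℝ)) = u ^ (-(3 / 2 : ℝ)) := by
  rw [← Real.rpow_neg_one, ← Real.rpow_add hu, show (-1 + -(1 / 2 : ℝ)) = -(3 / 2 : ℝ) by norm_num]

/-- `u^{-3/2} u = u^{-1/2}` for `u > 0`. [folklore] -/
theorem rpow_neg_three_halves_mul {u : ℝ} (hu : 0 < u) :
    u ^ (-(3 / 2 : ℝ)) * u = u ^ (-(1 / 2 : ℝ)) := by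
  rw [← Real.rpow_add_one hu.ne', show (-(3 / 2 : ℝ) + 1) = -(1 / 2 : ℝ) by norm_num]

/-- For `u > 0`: `d/du [(t − log u) u^{-1/2}] = −u^{-3/2}(1 + (t − log u)/2)`. [folklore] -/
theorem hasDerivAt_weight (t : ℝ) {u : ℝ} (hu : 0 < u) :
    HasDerivAt (fun v : ℝ ↦ (t - Real.log v) * v ^ (-(1 / 2 : ℝ)))
      (-(u ^ (-(3 / 2 : ℝ)) * (1 + (t - Real.log u) / 2))) u := by
  have h1 : HasDerivAt (fun v : ℝ ↦ t - Real.log v) (-u⁻¹) u :=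
    (Real.hasDerivAt_log hu.ne').const_sub t
  have h2 : HasDerivAt (fun v : ℝ ↦ v ^ (-(1 / 2 : ℝ)))
      (-(1 / 2 : ℝ) * u ^ (-(1 / 2 : ℝ) - 1)) u :=
    Real.hasDerivAt_rpow_const (Or.inl hu.ne')
  refine (h1.mul h2).congr_deriv ?_
  rw [show (-(1 / 2 : ℝ) - 1) = -(3 / 2 : ℝ) by norm_num, ← inv_mul_rpow_neg_half hu]
  ring

/-- For `u > 0`: `d/du [u^{1/2}(t − log u + 4)] = u^{-3/2}(1 + (t − log u)/2) · u`. [folklore] -/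
theorem hasDerivAt_primitive (t : ℝ) {u : ℝ} (hu : 0 < u) :
    HasDerivAt (fun v : ℝ ↦ v ^ (1 / 2 : ℝ) * (t - Real.log v + 4))
      (u ^ (-(3 / 2 : ℝ)) * (1 + (t - Real.log u) / 2) * u) u := by
  have h1 : HasDerivAt (fun v : ℝ ↦ v ^ (1 / 2 : ℝ)) ((1 / 2 : ℝ) * u ^ ((1 / 2 : ℝ) - 1)) u :=
    Real.hasDerivAt_rpow_const (Or.inl hu.ne')
  have h2 : HasDerivAt (fun v : ℝ ↦ t - Real.log v + 4) (-u⁻¹) u :=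
    ((Real.hasDerivAt_log hu.ne').const_sub t).add_const 4
  refine (h1.mul h2).congr_deriv ?_
  have eL : u ^ (-(3 / 2 : ℝ)) * (1 + (t - Real.log u) / 2) * u =
      u ^ (-(1 / 2 : ℝ)) * (1 + (t - Real.log u) / 2) := by
    rw [mul_right_comm, rpow_neg_three_halves_mul hu]
  -- `u^{1/2} u⁻¹ = u^{-1/2}`
  have eR : u ^ (1 / 2 : ℝ) * u⁻¹ = u ^ (-(1 / 2 : ℝ)) := by
    rw [← div_eq_mul_inv, ← Real.rpow_sub_one hu.ne',
      show ((1 / 2 : ℝ) - 1) = -(1 / 2 : ℝ) by norm_num]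
  rw [eL, show ((1 / 2 : ℝ) - 1) = -(1 / 2 : ℝ) by norm_num, mul_neg, eR]
  ring

/-- The kernel `u ↦ u^{-3/2}(1 + (t − log u)/2)` is continuous on `(0, ∞)`. [folklore] -/
theorem continuousOn_kernel (t : ℝ) :
    ContinuousOn (fun u : ℝ ↦ u ^ (-(3 / 2 : ℝ)) * (1 + (t - Real.log u) / 2)) (Set.Ioi 0) := by
  refine ContinuousOn.mul (continuousOn_id.rpow_const fun u (hu : 0 < u) ↦ Or.inl hu.ne') ?_
  exact continuousOn_const.add
    ((continuousOn_const.sub (continuousOn_id.log fun u (hu : 0 < u) ↦ hu.ne')).div_const _)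

/-- The kernel is continuous on `[1, x]`. [folklore] -/
theorem continuousOn_kernel_Icc (t x : ℝ) :
    ContinuousOn (fun u : ℝ ↦ u ^ (-(3 / 2 : ℝ)) * (1 + (t - Real.log u) / 2)) (Set.Icc 1 x) :=
  (continuousOn_kernel t).mono fun _ hu ↦ one_pos.trans_le hu.1

/-! ### Abel summation and the main term -/

/-- **Abel summation for `φ`.** For `t ≥ 0`,
`φ(t) = ∑_{n ≤ e^t} Λ(n) n^{-1/2}(t − log n) = ∫_1^{e^t} u^{-3/2}(1 + (t − log u)/2) ψ(u) du`
(Abel summation, Montgomery–Vaughan §2.1, with the weight `f(u) = (t − log u)u^{-1/2}`, which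
vanishes at `u = e^t`). [cite: MontgomeryVaughan2007, §2.1 (Abel summation)] -/
theorem zetaScrewPrimeSum_eq_integral {t : ℝ} (ht : 0 ≤ t) :
    zetaScrewPrimeSum t =
      ∫ u in (1 : ℝ)..Real.exp t, u ^ (-(3 / 2 : ℝ)) * (1 + (t - Real.log u) / 2) * ψ u := by
  have hx1 : (1 : ℝ) ≤ Real.exp t := Real.one_le_exp ht
  have hderiv : ∀ u ∈ Set.Icc (1 : ℝ) (Real.exp t),
      HasDerivAt (fun v : ℝ ↦ (t - Real.log v) * v ^ (-(1 / 2 : ℝ)))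
        (-(u ^ (-(3 / 2 : ℝ)) * (1 + (t - Real.log u) / 2))) u :=
    fun u hu ↦ hasDerivAt_weight t (one_pos.trans_le hu.1)
  have hf_diff : ∀ u ∈ Set.Icc (1 : ℝ) (Real.exp t),
      DifferentiableAt ℝ (fun v : ℝ ↦ (t - Real.log v) * v ^ (-(1 / 2 : ℝ))) u :=
    fun u hu ↦ (hderiv u hu).differentiableAt
  have hderiv_eq : ∀ u ∈ Set.Icc (1 : ℝ) (Real.exp t),
      deriv (fun v : ℝ ↦ (t - Real.log v) * v ^ (-(1 / 2 : ℝ))) u =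
        -(u ^ (-(3 / 2 : ℝ)) * (1 + (t - Real.log u) / 2)) :=
    fun u hu ↦ (hderiv u hu).deriv
  have hf_int : IntegrableOn (deriv (fun v : ℝ ↦ (t - Real.log v) * v ^ (-(1 / 2 : ℝ))))
      (Set.Icc (1 : ℝ) (Real.exp t)) :=
    ((continuousOn_kernel_Icc t (Real.exp t)).neg.integrableOn_Icc).congr_fun
      (fun u hu ↦ (hderiv_eq u hu).symm) measurableSet_Icc
  have habel := sum_mul_eq_sub_integral_mul₀ (⇑Λ) (by simp) (Real.exp t) hf_diff hf_int
  have hfx : (t - Real.log (Real.exp t)) * Real.exp t ^ (-(1 / 2 : ℝ)) = 0 := by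
    rw [Real.log_exp, sub_self, zero_mul]
  rw [hfx, zero_mul, zero_sub, ← Finset.add_sum_Ioc_eq_sum_Icc (Nat.zero_le _),
    ArithmeticFunction.map_zero, mul_zero, zero_add] at habel
  have hsum : ∑ n ∈ Finset.Icc 1 ⌊Real.exp t⌋₊,
      ArithmeticFunction.vonMangoldt n / Real.sqrt n * (t - Real.log n) =
        ∑ k ∈ Finset.Ioc 0 ⌊Real.exp t⌋₊,
          (t - Real.log (k : ℝ)) * (k : ℝ) ^ (-(1 / 2 : ℝ)) * Λ k := by
    refine Finset.sum_congr (Finset.Icc_add_one_left_eq_Ioc 0 _) fun n _ ↦ ?_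
    rw [Real.sqrt_eq_rpow, Real.rpow_neg (Nat.cast_nonneg n)]
    ring
  rw [zetaScrewPrimeSum, abs_of_nonneg ht]
  calc ∑ n ∈ Finset.Icc 1 ⌊Real.exp t⌋₊,
      ArithmeticFunction.vonMangoldt n / Real.sqrt n * (t - Real.log n)
      = ∑ k ∈ Finset.Ioc 0 ⌊Real.exp t⌋₊,
          (t - Real.log (k : ℝ)) * (k : ℝ) ^ (-(1 / 2 : ℝ)) * Λ k := hsum
    _ = -∫ u in Set.Ioc 1 (Real.exp t),
          deriv (fun v : ℝ ↦ (t - Real.log v) * v ^ (-(1 / 2 : ℝ))) u *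
            ∑ k ∈ Finset.Icc 0 ⌊u⌋₊, Λ k := habel
    _ = ∫ u in Set.Ioc 1 (Real.exp t),
          u ^ (-(3 / 2 : ℝ)) * (1 + (t - Real.log u) / 2) * ψ u := by
        rw [← MeasureTheory.integral_neg]
        refine setIntegral_congr_fun measurableSet_Ioc fun u hu ↦ ?_
        rw [hderiv_eq u (Set.Ioc_subset_Icc_self hu), Chebyshev.psi_eq_sum_Icc, neg_mul, neg_neg]
    _ = ∫ u in (1 : ℝ)..Real.exp t, u ^ (-(3 / 2 : ℝ)) * (1 + (t - Real.log u) / 2) * ψ u :=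
        (intervalIntegral.integral_of_le hx1).symm

/-- **The main term.** For `t ≥ 0`, `∫_1^{e^t} u^{-3/2}(1 + (t − log u)/2) · u du = 4e^{t/2} − t − 4`
(the integrand is the derivative of `u^{1/2}(t − log u + 4)`). [folklore] -/
theorem integral_kernel_mul_self {t : ℝ} (ht : 0 ≤ t) :
    ∫ u in (1 : ℝ)..Real.exp t, u ^ (-(3 / 2 : ℝ)) * (1 + (t - Real.log u) / 2) * u
      = 4 * Real.exp (t / 2) - t - 4 := by
  have hx1 : (1 : ℝ) ≤ Real.exp t := Real.one_le_exp ht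
  have hderiv : ∀ u ∈ Set.uIcc (1 : ℝ) (Real.exp t),
      HasDerivAt (fun v : ℝ ↦ v ^ (1 / 2 : ℝ) * (t - Real.log v + 4))
        (u ^ (-(3 / 2 : ℝ)) * (1 + (t - Real.log u) / 2) * u) u := by
    intro u hu
    rw [Set.uIcc_of_le hx1] at hu
    exact hasDerivAt_primitive t (one_pos.trans_le hu.1)
  have hint : IntervalIntegrable
      (fun u : ℝ ↦ u ^ (-(3 / 2 : ℝ)) * (1 + (t - Real.log u) / 2) * u) volume 1 (Real.exp t) :=
    ((continuousOn_kernel_Icc t (Real.exp t)).mul continuousOn_id).intervalIntegrable_of_Icc hx1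
  rw [intervalIntegral.integral_eq_sub_of_hasDerivAt hderiv hint]
  have h1 : Real.exp t ^ (1 / 2 : ℝ) = Real.exp (t / 2) := by
    rw [← Real.exp_mul]; congr 1; ring
  rw [h1, Real.log_exp, Real.log_one, Real.one_rpow]
  ring

/-- Pointwise majorant for the error integrand: for `c ≥ 0`, `u ≥ 1`, `log u ≤ t`,
`u^{-1/2} e^{−c√log u} ≤ (1 + e^{t/4 − c√t}) u^{-3/4}` (from `exp_quarter_sub_sqrt_le` with
`L = log u`). [folklore] -/
theorem rpow_mul_exp_le {c t u : ℝ} (hc : 0 ≤ c) (hu : 1 ≤ u) (hut : Real.log u ≤ t) :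
    u ^ (-(1 / 2 : ℝ)) * Real.exp (-(c * Real.sqrt (Real.log u))) ≤
      (1 + Real.exp (t / 4 - c * Real.sqrt t)) * u ^ (-(3 / 4 : ℝ)) := by
  have hu0 : 0 < u := one_pos.trans_le hu
  have hL0 : 0 ≤ Real.log u := Real.log_nonneg hu
  have key := exp_quarter_sub_sqrt_le hc hL0 hut
  rw [Real.rpow_def_of_pos hu0, Real.rpow_def_of_pos hu0, ← Real.exp_add]
  calc Real.exp (Real.log u * -(1 / 2 : ℝ) + -(c * Real.sqrt (Real.log u)))
      = Real.exp (Real.log u / 4 - c * Real.sqrt (Real.log u)) *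
          Real.exp (Real.log u * -(3 / 4 : ℝ)) := by
        rw [← Real.exp_add]; congr 1; ring
    _ ≤ (1 + Real.exp (t / 4 - c * Real.sqrt t)) * Real.exp (Real.log u * -(3 / 4 : ℝ)) :=
        mul_le_mul_of_nonneg_right key (Real.exp_pos _).le

/-- **Prop. 2.1 with the polynomial factors explicit.** If `|ψ(u) − u| ≤ C u e^{−c√log u}` for
`u ≥ 1` (`c, C ≥ 0`), then for every `t > 0`
`|φ(t) − (4e^{t/2} − t − 4)| ≤ 4C(1 + t)(e^{t/4} + e^{t/2 − c√t})`. [folklore] -/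
theorem abs_zetaScrewPrimeSum_sub_le {c C : ℝ} (hc : 0 ≤ c) (hC : 0 ≤ C)
    (hψ : ∀ u : ℝ, 1 ≤ u → |ψ u - u| ≤ C * u * Real.exp (-(c * Real.sqrt (Real.log u))))
    {t : ℝ} (ht : 0 < t) :
    |zetaScrewPrimeSum t - (4 * Real.exp (t / 2) - t - 4)| ≤
      4 * C * (1 + t) * (Real.exp (t / 4) + Real.exp (t / 2 - c * Real.sqrt t)) := by
  have hx1 : (1 : ℝ) ≤ Real.exp t := Real.one_le_exp ht.le
  have hcont := continuousOn_kernel_Icc t (Real.exp t)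
  -- integrability on `[1, e^t]`
  have hI_main : IntervalIntegrable
      (fun u : ℝ ↦ u ^ (-(3 / 2 : ℝ)) * (1 + (t - Real.log u) / 2) * u) volume 1 (Real.exp t) :=
    (hcont.mul continuousOn_id).intervalIntegrable_of_Icc hx1
  have hI_psi : IntervalIntegrable
      (fun u : ℝ ↦ u ^ (-(3 / 2 : ℝ)) * (1 + (t - Real.log u) / 2) * ψ u) volume 1 (Real.exp t) := by
    rw [intervalIntegrable_iff_integrableOn_Icc_of_le hx1]
    have h0 := integrableOn_mul_sum_Icc (⇑Λ) zero_le_one (m := 0) hcont.integrableOn_Icc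
    refine h0.congr_fun (fun u _ ↦ ?_) measurableSet_Icc
    rw [Chebyshev.psi_eq_sum_Icc]
  have hI_err : IntervalIntegrable
      (fun u : ℝ ↦ u ^ (-(3 / 2 : ℝ)) * (1 + (t - Real.log u) / 2) * (ψ u - u))
        volume 1 (Real.exp t) := by
    have hfun : (fun u : ℝ ↦ u ^ (-(3 / 2 : ℝ)) * (1 + (t - Real.log u) / 2) * (ψ u - u)) =
        fun u : ℝ ↦ u ^ (-(3 / 2 : ℝ)) * (1 + (t - Real.log u) / 2) * ψ u -
          u ^ (-(3 / 2 : ℝ)) * (1 + (t - Real.log u) / 2) * u := by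
      funext u; ring
    rw [hfun]
    exact hI_psi.sub hI_main
  -- `φ(t) = (4e^{t/2} − t − 4) + ∫ k (ψ − u)`
  have hφ : zetaScrewPrimeSum t = (4 * Real.exp (t / 2) - t - 4) +
      ∫ u in (1 : ℝ)..Real.exp t,
        u ^ (-(3 / 2 : ℝ)) * (1 + (t - Real.log u) / 2) * (ψ u - u) := by
    rw [zetaScrewPrimeSum_eq_integral ht.le, ← integral_kernel_mul_self ht.le,
      ← intervalIntegral.integral_add hI_main hI_err]
    refine intervalIntegral.integral_congr fun u _ ↦ ?_
    ring
  -- pointwise bound of the error integrand on `(1, e^t]`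
  have hbound : ∀ u ∈ Set.Ioc (1 : ℝ) (Real.exp t),
      ‖u ^ (-(3 / 2 : ℝ)) * (1 + (t - Real.log u) / 2) * (ψ u - u)‖ ≤
        C * (1 + t / 2) * (1 + Real.exp (t / 4 - c * Real.sqrt t)) * u ^ (-(3 / 4 : ℝ)) := by
    intro u hu
    have hu0 : 0 < u := one_pos.trans hu.1
    have hL0 : 0 ≤ Real.log u := Real.log_nonneg hu.1.le
    have hLt : Real.log u ≤ t := by
      rw [Real.log_le_iff_le_exp hu0]
      exact hu.2
    have hr0 : 0 ≤ u ^ (-(3 / 2 : ℝ)) := Real.rpow_nonneg hu0.le _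
    have hK0 : 0 ≤ u ^ (-(3 / 2 : ℝ)) * (1 + (t - Real.log u) / 2) :=
      mul_nonneg hr0 (by linarith)
    have hK1 : u ^ (-(3 / 2 : ℝ)) * (1 + (t - Real.log u) / 2) ≤ u ^ (-(3 / 2 : ℝ)) * (1 + t / 2) :=
      mul_le_mul_of_nonneg_left (by linarith) hr0
    rw [Real.norm_eq_abs, abs_mul, abs_of_nonneg hK0]
    calc u ^ (-(3 / 2 : ℝ)) * (1 + (t - Real.log u) / 2) * |ψ u - u|
        ≤ u ^ (-(3 / 2 : ℝ)) * (1 + t / 2) * (C * u * Real.exp (-(c * Real.sqrt (Real.log u)))) :=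
          mul_le_mul hK1 (hψ u hu.1.le) (abs_nonneg _) (by positivity)
      _ = C * (1 + t / 2) * (u ^ (-(1 / 2 : ℝ)) * Real.exp (-(c * Real.sqrt (Real.log u)))) := by
          rw [← rpow_neg_three_halves_mul hu0]; ring
      _ ≤ C * (1 + t / 2) * ((1 + Real.exp (t / 4 - c * Real.sqrt t)) * u ^ (-(3 / 4 : ℝ))) :=
          mul_le_mul_of_nonneg_left (rpow_mul_exp_le hc hu.1.le hLt) (by positivity)
      _ = C * (1 + t / 2) * (1 + Real.exp (t / 4 - c * Real.sqrt t)) * u ^ (-(3 / 4 : ℝ)) := by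
          ring
  have hI_bd : IntervalIntegrable
      (fun u : ℝ ↦ C * (1 + t / 2) * (1 + Real.exp (t / 4 - c * Real.sqrt t)) * u ^ (-(3 / 4 : ℝ)))
        volume 1 (Real.exp t) :=
    (intervalIntegral.intervalIntegrable_rpow' (by norm_num)).const_mul _
  have hR := intervalIntegral.norm_integral_le_of_norm_le hx1
    (Filter.Eventually.of_forall hbound) hI_bd
  rw [intervalIntegral.integral_const_mul, Real.norm_eq_abs] at hR
  have hJ := integral_rpow_neg_three_quarters_le ht.le
  have hEE : Real.exp (t / 4 - c * Real.sqrt t) * Real.exp (t / 4) =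
      Real.exp (t / 2 - c * Real.sqrt t) := by
    rw [← Real.exp_add]; congr 1; ring
  have hS0 : 0 ≤ Real.exp (t / 4) + Real.exp (t / 2 - c * Real.sqrt t) := by positivity
  rw [hφ, add_sub_cancel_left]
  calc |∫ u in (1 : ℝ)..Real.exp t, u ^ (-(3 / 2 : ℝ)) * (1 + (t - Real.log u) / 2) * (ψ u - u)|
      ≤ C * (1 + t / 2) * (1 + Real.exp (t / 4 - c * Real.sqrt t)) * (4 * Real.exp (t / 4)) :=
        hR.trans (mul_le_mul_of_nonneg_left hJ (by positivity))
    _ = 4 * C * (1 + t / 2) * (Real.exp (t / 4) + Real.exp (t / 2 - c * Real.sqrt t)) := by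
        rw [← hEE]; ring
    _ ≤ 4 * C * (1 + t) * (Real.exp (t / 4) + Real.exp (t / 2 - c * Real.sqrt t)) :=
        mul_le_mul_of_nonneg_right
          (mul_le_mul_of_nonneg_left (by linarith) (by positivity)) hS0

/-- The non-prime part of (1.1) is `O(1 + t)`: there is `A ≥ 0` with
`|4e^{-t/2} − 4 + t − (t/2)(γ₀ + π/2 + 3 log 2 + log π) + (1/4)(C − e^{-t/2}Φ(e^{-2t},2,1/4))| ≤ A(1 + t)`
for all `t > 0` (`0 < e^{-t/2} ≤ 1`, `0 ≤ Φ ≤ C`). [folklore] -/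
theorem abs_archimedean_part_le :
    ∃ A : ℝ, 0 ≤ A ∧ ∀ t : ℝ, 0 < t →
      |4 * Real.exp (-(t / 2)) - 4 + t
          - t / 2 * (Real.eulerMascheroniConstant + Real.pi / 2 + 3 * Real.log 2 + Real.log Real.pi)
          + 1 / 4 * ((∑' k : ℕ, 1 / ((k : ℝ) + 1 / 4) ^ 2)
              - Real.exp (-(t / 2)) * hurwitzLerchQuarter t)| ≤ A * (1 + t) := by
  set C₀ : ℝ := ∑' k : ℕ, 1 / ((k : ℝ) + 1 / 4) ^ 2 with hC₀
  set K₀ : ℝ := Real.eulerMascheroniConstant + Real.pi / 2 + 3 * Real.log 2 + Real.log Real.pi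
    with hK₀
  have hC₀0 : 0 ≤ C₀ := tsum_nonneg fun k ↦ by positivity
  have hKa : 0 ≤ |K₀| := abs_nonneg _
  refine ⟨5 + C₀ / 4 + |K₀| / 2, by positivity, fun t ht ↦ ?_⟩
  have hΦ0 : 0 ≤ hurwitzLerchQuarter t := hurwitzLerchQuarter_nonneg t
  have hΦ1 : hurwitzLerchQuarter t ≤ C₀ := hurwitzLerchQuarter_le t
  have he0 : 0 < Real.exp (-(t / 2)) := Real.exp_pos _
  have he1 : Real.exp (-(t / 2)) ≤ 1 := Real.exp_le_one_iff.2 (by linarith)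
  have hp0 : 0 ≤ Real.exp (-(t / 2)) * hurwitzLerchQuarter t := mul_nonneg he0.le hΦ0
  have hp1 : Real.exp (-(t / 2)) * hurwitzLerchQuarter t ≤ C₀ :=
    (mul_le_of_le_one_left hΦ0 he1).trans hΦ1
  have hk1 : t / 2 * K₀ ≤ t / 2 * |K₀| := mul_le_mul_of_nonneg_left (le_abs_self _) (by linarith)
  have hk2 : t / 2 * -|K₀| ≤ t / 2 * K₀ := mul_le_mul_of_nonneg_left (neg_abs_le _) (by linarith)
  have hCt : 0 ≤ C₀ * t := mul_nonneg hC₀0 ht.le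
  have hKt : 0 ≤ |K₀| * t := mul_nonneg hKa ht.le
  rw [abs_le]
  constructor
  · linarith
  · linarith

end ZetaScrewGrowth

open ZetaScrewGrowth in
/-- **Suzuki2023 Prop. 2.1**, PROVED. There exists `c > 0` such that
`∑_{n ≤ e^t} Λ(n) n^{-1/2}(t − log n) = 4e^{t/2} + O(e^{t/2} e^{−c√t})` for `t > 0`; here in the form
`|φ(t) − 4e^{t/2}| ≤ M e^{t/2 − c√t}` for all `t > 0`, `φ = zetaScrewPrimeSum`. (Proof here: Abel
summation from the de la Vallée Poussin prime number theorem instead of the paper's contour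
argument; see the module docstring.) [cite: Suzuki2023, Prop. 2.1] -/
theorem Suzuki2023_prop21 :
    ∃ c : ℝ, 0 < c ∧ ∃ M : ℝ, ∀ t : ℝ, 0 < t →
      |zetaScrewPrimeSum t - 4 * Real.exp (t / 2)| ≤ M * Real.exp (t / 2 - c * Real.sqrt t) := by
  obtain ⟨c, hc, C, hC, hψ⟩ := exists_abs_psi_sub_le_one_le
  refine ⟨c / 2, by positivity, (4 + 4 * C) * (8 * Real.exp (c ^ 2 / 2) + (1 + 8 / c ^ 2)),
    fun t ht ↦ ?_⟩
  have h1 := abs_zetaScrewPrimeSum_sub_le hc.le hC hψ ht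
  have h2 := absorb hc ht.le
  have hS1 : 1 ≤ Real.exp (t / 4) + Real.exp (t / 2 - c * Real.sqrt t) := by
    have : 1 ≤ Real.exp (t / 4) := Real.one_le_exp (by positivity)
    linarith [Real.exp_pos (t / 2 - c * Real.sqrt t)]
  have h3 : |zetaScrewPrimeSum t - 4 * Real.exp (t / 2)| ≤
      |zetaScrewPrimeSum t - (4 * Real.exp (t / 2) - t - 4)| + (t + 4) := by
    have h := abs_sub_le (zetaScrewPrimeSum t) (4 * Real.exp (t / 2) - t - 4) (4 * Real.exp (t / 2))
    have h4 : |4 * Real.exp (t / 2) - t - 4 - 4 * Real.exp (t / 2)| = t + 4 := by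
      rw [show 4 * Real.exp (t / 2) - t - 4 - 4 * Real.exp (t / 2) = -(t + 4) by ring, abs_neg,
        abs_of_pos (by linarith)]
    linarith
  have h5 : 4 * (1 + t) * 1 ≤ 4 * (1 + t) * (Real.exp (t / 4) + Real.exp (t / 2 - c * Real.sqrt t)) :=
    mul_le_mul_of_nonneg_left hS1 (by positivity)
  have hM : 0 ≤ 4 + 4 * C := by positivity
  calc |zetaScrewPrimeSum t - 4 * Real.exp (t / 2)|
      ≤ 4 * C * (1 + t) * (Real.exp (t / 4) + Real.exp (t / 2 - c * Real.sqrt t)) + (t + 4) :=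
        h3.trans (by linarith)
    _ ≤ (4 + 4 * C) * ((1 + t) * (Real.exp (t / 4) + Real.exp (t / 2 - c * Real.sqrt t))) := by
        linarith
    _ ≤ (4 + 4 * C) * ((8 * Real.exp (c ^ 2 / 2) + (1 + 8 / c ^ 2)) *
          Real.exp (t / 2 - c / 2 * Real.sqrt t)) :=
        mul_le_mul_of_nonneg_left h2 hM
    _ = (4 + 4 * C) * (8 * Real.exp (c ^ 2 / 2) + (1 + 8 / c ^ 2)) *
          Real.exp (t / 2 - c / 2 * Real.sqrt t) := by ring

open ZetaScrewGrowth in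
/-- **Suzuki2023 Thm 1.1 (3)**, PROVED (discharges the named fact `Suzuki2023_thm11_growth`):
`Ψ(t) ≪ exp(t/2 − c√t)` for some `c > 0`, i.e. there are `c > 0` and `M` with
`|Ψ(t)| ≤ M e^{t/2 − c√t}` for all `t > 0`. As in §2.3 of the source: by (1.1) (`zetaScrew_eq`),
`Ψ(t) = [4e^{-t/2} − 4 + t − (t/2)K + (1/4)(C − e^{-t/2}Φ)] − [φ(t) − (4e^{t/2} − t − 4)]`, the first
bracket is `O(1 + t)` (`abs_archimedean_part_le`) and the second is Prop. 2.1
(`abs_zetaScrewPrimeSum_sub_le`, from the de la Vallée Poussin prime number theorem).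
[cite: Suzuki2023, Thm 1.1 (3)] -/
theorem Suzuki2023_thm11_growth_holds : Suzuki2023_thm11_growth := by
  obtain ⟨c, hc, C, hC, hψ⟩ := exists_abs_psi_sub_le_one_le
  obtain ⟨A, hA, hB⟩ := abs_archimedean_part_le
  refine ⟨c / 2, by positivity, (A + 4 * C) * (8 * Real.exp (c ^ 2 / 2) + (1 + 8 / c ^ 2)),
    fun t ht ↦ ?_⟩
  have h1 := abs_zetaScrewPrimeSum_sub_le hc.le hC hψ ht
  have h2 := absorb hc ht.le
  have h3 := hB t ht
  have hS1 : 1 ≤ Real.exp (t / 4) + Real.exp (t / 2 - c * Real.sqrt t) := by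
    have : 1 ≤ Real.exp (t / 4) := Real.one_le_exp (by positivity)
    linarith [Real.exp_pos (t / 2 - c * Real.sqrt t)]
  have h4 : A * (1 + t) * 1 ≤ A * (1 + t) * (Real.exp (t / 4) + Real.exp (t / 2 - c * Real.sqrt t)) :=
    mul_le_mul_of_nonneg_left hS1 (by positivity)
  have hM : 0 ≤ A + 4 * C := by positivity
  have hz : zetaScrew t =
      (4 * Real.exp (-(t / 2)) - 4 + t
          - t / 2 * (Real.eulerMascheroniConstant + Real.pi / 2 + 3 * Real.log 2 + Real.log Real.pi)
          + 1 / 4 * ((∑' k : ℕ, 1 / ((k : ℝ) + 1 / 4) ^ 2)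
              - Real.exp (-(t / 2)) * hurwitzLerchQuarter t))
        - (zetaScrewPrimeSum t - (4 * Real.exp (t / 2) - t - 4)) := by
    rw [zetaScrew_eq, abs_of_pos ht]
    ring
  rw [hz]
  calc _ ≤ _ := abs_sub _ _
    _ ≤ A * (1 + t) + 4 * C * (1 + t) * (Real.exp (t / 4) + Real.exp (t / 2 - c * Real.sqrt t)) :=
        add_le_add h3 h1
    _ ≤ (A + 4 * C) * ((1 + t) * (Real.exp (t / 4) + Real.exp (t / 2 - c * Real.sqrt t))) := by
        linarith
    _ ≤ (A + 4 * C) * ((8 * Real.exp (c ^ 2 / 2) + (1 + 8 / c ^ 2)) *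
          Real.exp (t / 2 - c / 2 * Real.sqrt t)) :=
        mul_le_mul_of_nonneg_left h2 hM
    _ = (A + 4 * C) * (8 * Real.exp (c ^ 2 / 2) + (1 + 8 / c ^ 2)) *
          Real.exp (t / 2 - c / 2 * Real.sqrt t) := by ring

end Literature.NumberTheory.LFunctions
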